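import Literature.NumberTheory.Transcendental.KZIntervalPeriodProofs

/-!
# `BetaCancellation` (stmt-KontsevichZagierPeriods-13633), line `dirichlet-companion-to-pi`: stub `stub_weightSemialgebraic`

The showcase weight of the weight-descent line, `w₁ x = (1 + x)·√(1 − x²)` (Mathlib's `Real.sqrt`
vanishes on negatives, so `w₁ = 0` off `[-1, 1]`), is admissible: as a function of the single
coordinate of `ℝ¹` it is `ℚ`-semialgebraic on all of `ℝ¹` (a polynomial times the square root of a
polynomial; products and square roots of real semialgebraic functions are semialgebraic,
Bochnak–Coste–Roy Prop. 2.2.6), and it is bounded by `2` (`|1 + t| ≤ 2` and `√(1 − t²) ≤ 1` when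
`t² ≤ 1`, and `√(1 − t²) = 0` otherwise).

No definitions; namespace of the line skeleton.
-/

noncomputable section

set_option linter.dupNamespace false

namespace Summit.KontsevichZagierPeriods.KontsevichZagierPeriods.BetaCancellationLine

open Set MvPolynomial
open Literature.ModelTheory.ExponentialFields (IsSemialgebraic isSemialgebraic_univ)
open Literature.NumberTheory.Transcendental
open Literature.NumberTheory.Transcendental.KZ

-- adapted from Summits/KontsevichZagierPeriods/KontsevichZagierPeriods/Theorems/TerasomaMultiplicationBetaCancellationStubTriangleConst.lean
-- (`isSemialgebraicFunOn_edge`: polynomial atoms by `isSemialgebraicFunOn_aeval` + `congr`)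

/-- The affine factor `x ↦ 1 + x` is `ℚ`-semialgebraic on `ℝ¹` (it is a polynomial over `ℚ`).
[folklore] -/
theorem weightSemialgebraic_isSemialgebraicFunOn_affine :
    IsSemialgebraicFunOn ℚ (Set.univ : Set (Fin 1 → ℝ)) (fun x => 1 + x 0) :=
  (isSemialgebraicFunOn_aeval (isSemialgebraic_univ (k := ℚ) (ι := Fin 1)) (1 + X 0)).congr
    fun x _ => by simp

/-- The radicand `x ↦ 1 - x²` is `ℚ`-semialgebraic on `ℝ¹` (it is a polynomial over `ℚ`).
[folklore] -/
theorem weightSemialgebraic_isSemialgebraicFunOn_radicand :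
    IsSemialgebraicFunOn ℚ (Set.univ : Set (Fin 1 → ℝ)) (fun x => 1 - x 0 ^ 2) :=
  (isSemialgebraicFunOn_aeval (isSemialgebraic_univ (k := ℚ) (ι := Fin 1)) (1 - X 0 ^ 2)).congr
    fun x _ => by simp

/-- The half-circle profile `x ↦ √(1 - x²)` (junk value `0` off `[-1, 1]`) is `ℚ`-semialgebraic on
`ℝ¹`: square roots of real semialgebraic functions are semialgebraic. [folklore] -/
theorem weightSemialgebraic_isSemialgebraicFunOn_sqrt :
    IsSemialgebraicFunOn ℚ (Set.univ : Set (Fin 1 → ℝ)) (fun x => Real.sqrt (1 - x 0 ^ 2)) :=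
  IsSemialgebraicFunOn.sqrt_holds weightSemialgebraic_isSemialgebraicFunOn_radicand

/-- The weight `x ↦ (1 + x)·√(1 - x²)` is `ℚ`-semialgebraic on `ℝ¹`: a product of two real
semialgebraic functions (Tarski–Seidenberg, Bochnak–Coste–Roy Prop. 2.2.6). [folklore] -/
theorem weightSemialgebraic_isSemialgebraicFunOn :
    IsSemialgebraicFunOn ℚ (Set.univ : Set (Fin 1 → ℝ))
      (fun x => (1 + x 0) * Real.sqrt (1 - x 0 ^ 2)) :=
  (IsSemialgebraicFunOn.mul_holds weightSemialgebraic_isSemialgebraicFunOn_affine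
    weightSemialgebraic_isSemialgebraicFunOn_sqrt).congr fun x _ => by simp [Pi.mul_apply]

/-- The weight is bounded by `2`: for `t² ≤ 1` one has `|1 + t| ≤ 2` and `√(1 - t²) ≤ 1`; for
`t² > 1` the square root vanishes. [folklore] -/
theorem weightSemialgebraic_abs_le (t : ℝ) : |(1 + t) * Real.sqrt (1 - t ^ 2)| ≤ 2 := by
  rcases le_or_gt (t ^ 2) 1 with h | h
  · have ht : |t| ≤ 1 := (sq_le_one_iff_abs_le_one t).mp h
    have ht' := abs_le.mp ht
    have h1 : |1 + t| ≤ 2 := abs_le.mpr ⟨by linarith [ht'.1], by linarith [ht'.2]⟩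
    have h2 : Real.sqrt (1 - t ^ 2) ≤ 1 := Real.sqrt_le_one.mpr (by nlinarith [sq_nonneg t])
    rw [abs_mul, abs_of_nonneg (Real.sqrt_nonneg _)]
    calc |1 + t| * Real.sqrt (1 - t ^ 2) ≤ 2 * 1 :=
        mul_le_mul h1 h2 (Real.sqrt_nonneg _) (by norm_num)
      _ = 2 := by norm_num
  · have h0 : Real.sqrt (1 - t ^ 2) = 0 := Real.sqrt_eq_zero'.mpr (by linarith)
    rw [h0, mul_zero, abs_zero]
    norm_num

/-- **The showcase weight is admissible**: `w₁ x = (1 + x)·√(1 − x²)` (Mathlib's `√` vanishes on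
negatives, so `w₁ = 0` off `[-1, 1]`) is `ℚ`-semialgebraic on `ℝ¹` and bounded by `2`. [folklore] -/
theorem stub_weightSemialgebraic :
    IsSemialgebraicFunOn ℚ (Set.univ : Set (Fin 1 → ℝ)) (fun x => (1 + x 0) * Real.sqrt (1 - x 0 ^ 2)) ∧
    ∀ t : ℝ, |(1 + t) * Real.sqrt (1 - t ^ 2)| ≤ 2 :=
  ⟨weightSemialgebraic_isSemialgebraicFunOn, weightSemialgebraic_abs_le⟩

end Summit.KontsevichZagierPeriods.KontsevichZagierPeriods.BetaCancellationLine
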